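import Summits.AtomisticToContinuum.Crystallization.Theorems.CoarseGrains.Negative.LoadBearing

/-!
# `CoarseGrains` / Negative: the threshold `N₀(R)` is at least cubic in the radius

Negative knowledge for crux `stmt-AtomisticToContinuum-9331` (`ExcessDecayLiouville.CoarseGrains`),
standing crux-disprover seat `refuter-cdisprove-stmt-AtomisticToContinuum-9331-g2-0` (cycle 2,
2026-08-16); builds on `Negative.PredicateAPI`, `Negative.LoadBearing`.  Nothing here closes an item; no
theorem concludes a Theses decl.

* `cube_le_card_of_near`: a two-way `1/40`-matched ball of radius `R ≥ 11/10 + 4K` contains the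
  `(K+1)³` sites `t 0 + A (z₀ + i u + j v + k ℓ)` (`0 ≤ i, j, k ≤ K`, `ℓ = 2√(2/3)e₃`, `z₀` the site within
  `11/10` of the centre), pairwise `≥ 189/200` apart, each owning its own particle: `(K+1)³ ≤ N`.
* `coarseGrains_threshold_cubic`: hence any threshold `N₀` valid at radius `R ≥ 11/10 + 4K` satisfies
  `(K+1)³ ≤ N₀` (ground states of every size exist) — `N₀(R) ≥ ((R − 11/10)/4)³`, the honest order of
  magnitude being `≈ 6.5·R³` (two sublattices of covolume `√2·det A`).  Largeness is load-bearing at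
  EVERY scale, not just at `N = 0` (`LoadBearing.coarseGrains_false_without_largeness`).
-/

noncomputable section

open Literature.MathematicalPhysics.StatisticalMechanics

namespace Summit.AtomisticToContinuum.Crystallization.Theorems.CoarseGrains.Negative.CubicThreshold

open Summit.AtomisticToContinuum.Crystallization.Theorems.CoarseGrains.Negative.PredicateAPI
open Summit.AtomisticToContinuum.Crystallization.Theorems.CoarseGrains.Negative.LoadBearing

/-- `‖v‖ = 1` for `v = triangularVec₂ 1 = (1/2, √3/2, 0)`. [folklore] -/
theorem norm_triangularVec₂ : ‖(triangularVec₂ 1 : E3)‖ = 1 := by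
  have h : ‖(triangularVec₂ 1 : E3)‖ ^ 2 = 1 := by
    rw [EuclideanSpace.norm_eq, Real.sq_sqrt (by positivity), Fin.sum_univ_three]
    simp [triangularVec₂, Real.norm_eq_abs, sq_abs, div_pow, Real.sq_sqrt (show (0:ℝ) ≤ 3 by norm_num)]
    norm_num
  nlinarith [norm_nonneg (triangularVec₂ 1 : E3)]

/-- `‖ℓ‖ ≤ 2` for the layer period `ℓ = 2√(2/3)e₃`. [folklore] -/
theorem norm_layerPeriod_le : ‖(layerNormal (2 * Real.sqrt (2 / 3)) : E3)‖ ≤ 2 := by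
  have h : ‖(layerNormal (2 * Real.sqrt (2 / 3)) : E3)‖ ^ 2 = 8 / 3 := by
    have := lam_norm_sq 0 0 1
    simpa using this
  nlinarith [norm_nonneg (layerNormal (2 * Real.sqrt (2 / 3)) : E3)]

/-- `‖i u + j v + k ℓ‖ ≤ i + j + 2k` for naturals `i, j, k`. [folklore] -/
theorem norm_natVec_le (i j k : ℕ) :
    ‖((i : ℝ) • triangularVec₁ 1 + (j : ℝ) • triangularVec₂ 1 +
      (k : ℝ) • layerNormal (2 * Real.sqrt (2 / 3)) : E3)‖ ≤ i + j + 2 * k := by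
  have h1 : ‖((i : ℝ) • triangularVec₁ 1 : E3)‖ = i := by
    rw [norm_smul, norm_triangularVec₁, Real.norm_eq_abs, abs_of_nonneg (by positivity), mul_one]
  have h2 : ‖((j : ℝ) • triangularVec₂ 1 : E3)‖ = j := by
    rw [norm_smul, norm_triangularVec₂, Real.norm_eq_abs, abs_of_nonneg (by positivity), mul_one]
  have h3 : ‖((k : ℝ) • layerNormal (2 * Real.sqrt (2 / 3)) : E3)‖ ≤ 2 * k := by
    rw [norm_smul, Real.norm_eq_abs, abs_of_nonneg (by positivity)]
    nlinarith [norm_layerPeriod_le, (Nat.cast_nonneg k : (0 : ℝ) ≤ k)]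
  calc ‖((i : ℝ) • triangularVec₁ 1 + (j : ℝ) • triangularVec₂ 1 +
        (k : ℝ) • layerNormal (2 * Real.sqrt (2 / 3)) : E3)‖
      ≤ ‖((i : ℝ) • triangularVec₁ 1 + (j : ℝ) • triangularVec₂ 1 : E3)‖ +
        ‖((k : ℝ) • layerNormal (2 * Real.sqrt (2 / 3)) : E3)‖ := norm_add_le _ _
    _ ≤ ‖((i : ℝ) • triangularVec₁ 1 : E3)‖ + ‖((j : ℝ) • triangularVec₂ 1 : E3)‖ +
        ‖((k : ℝ) • layerNormal (2 * Real.sqrt (2 / 3)) : E3)‖ := by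
          gcongr; exact norm_add_le _ _
    _ ≤ i + j + 2 * k := by rw [h1, h2]; linarith

/-- The map `(i, j, k) ↦ i u + j v + k ℓ` is injective on `ℕ³` (read off the coordinates). [folklore] -/
theorem natVec_injective {i j k i' j' k' : ℕ}
    (h : ((i : ℝ) • triangularVec₁ 1 + (j : ℝ) • triangularVec₂ 1 +
      (k : ℝ) • layerNormal (2 * Real.sqrt (2 / 3)) : E3) =
      (i' : ℝ) • triangularVec₁ 1 + (j' : ℝ) • triangularVec₂ 1 +
      (k' : ℝ) • layerNormal (2 * Real.sqrt (2 / 3))) : i = i' ∧ j = j' ∧ k = k' := by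
  obtain ⟨a0, a1, a2⟩ := lamVec_apply (i : ℝ) j k
  obtain ⟨b0, b1, b2⟩ := lamVec_apply (i' : ℝ) j' k'
  have e0 := congrArg (fun w : E3 => w 0) h
  have e1 := congrArg (fun w : E3 => w 1) h
  have e2 := congrArg (fun w : E3 => w 2) h
  simp only at e0 e1 e2
  rw [a0, b0] at e0
  rw [a1, b1] at e1
  rw [a2, b2] at e2
  have hs3 : (0 : ℝ) < Real.sqrt 3 / 2 := by positivity
  have hc : (0 : ℝ) < 2 * Real.sqrt (2 / 3) := by positivity
  have hj : (j : ℝ) = j' := by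
    have := mul_right_cancel₀ hs3.ne' e1
    exact this
  have hk : (k : ℝ) = k' := mul_right_cancel₀ hc.ne' e2
  have hi : (i : ℝ) = i' := by rw [hj] at e0; linarith
  exact ⟨by exact_mod_cast hi, by exact_mod_cast hj, by exact_mod_cast hk⟩

/-- **A matched ball of radius `11/10 + 4K` needs `(K+1)³` particles.** [folklore] -/
theorem cube_le_card_of_near {N : ℕ} {x : Fin N → E3} {c : E3} {R : ℝ} {t : Fin 2 → E3}
    {A : E3 →L[ℝ] E3} (hA : Adm A) (hN : Near (Set.range x) c R t A (1 / 40)) (K : ℕ)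
    (hR : 11 / 10 + 4 * K ≤ R) : (K + 1) ^ 3 ≤ N := by
  obtain ⟨z₀, hz₀, hz₀c⟩ := exists_site_near hA (t 0) c
  -- the sites, indexed by triples
  let vec : Fin (K + 1) × Fin (K + 1) × Fin (K + 1) → E3 := fun q =>
    ((q.1 : ℕ) : ℝ) • triangularVec₁ 1 + ((q.2.1 : ℕ) : ℝ) • triangularVec₂ 1 +
      ((q.2.2 : ℕ) : ℝ) • layerNormal (2 * Real.sqrt (2 / 3))
  let s : Fin (K + 1) × Fin (K + 1) × Fin (K + 1) → E3 := fun q => t 0 + A (z₀ + vec q)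
  have hvec_mem : ∀ q, z₀ + vec q ∈ Lam := fun q => by
    refine lam_add_mem hz₀ ?_
    have := mem_lam (q.1 : ℕ) (q.2.1 : ℕ) (q.2.2 : ℕ)
    push_cast at this
    exact this
  have hs_ball : ∀ q, dist (s q) c ≤ R := by
    intro q
    have hq1 : ((q.1 : ℕ) : ℝ) ≤ K := by exact_mod_cast Nat.lt_succ_iff.1 q.1.2
    have hq2 : ((q.2.1 : ℕ) : ℝ) ≤ K := by exact_mod_cast Nat.lt_succ_iff.1 q.2.1.2
    have hq3 : ((q.2.2 : ℕ) : ℝ) ≤ K := by exact_mod_cast Nat.lt_succ_iff.1 q.2.2.2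
    have h1 : dist (s q) (t 0 + A z₀) = ‖A (vec q)‖ := by
      rw [dist_site_site]; congr 1; abel_nf
    have h2 : ‖A (vec q)‖ ≤ (199 / 200) * ‖vec q‖ := adm_norm_le hA _
    have h3 : ‖vec q‖ ≤ (q.1 : ℕ) + (q.2.1 : ℕ) + 2 * (q.2.2 : ℕ) := norm_natVec_le _ _ _
    have h4 : ‖vec q‖ ≤ 4 * K := by linarith
    calc dist (s q) c ≤ dist (s q) (t 0 + A z₀) + dist (t 0 + A z₀) c := dist_triangle _ _ _
      _ ≤ (199 / 200) * (4 * K) + 11 / 10 := by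
          rw [h1]; nlinarith [norm_nonneg (vec q)]
      _ ≤ R := by nlinarith
  have hown : ∀ q, ∃ i : Fin N, dist (x i) (s q) ≤ 1 / 40 := by
    intro q
    obtain ⟨p, ⟨i, rfl⟩, hp⟩ := hN.2 0 _ (hvec_mem q) (hs_ball q)
    exact ⟨i, hp⟩
  choose f hf using hown
  have hinj : Function.Injective f := by
    intro q q' hqq
    by_contra hne
    have hne' : z₀ + vec q ≠ z₀ + vec q' := by
      intro h
      have h' : vec q = vec q' := add_left_cancel h
      obtain ⟨e1, e2, e3⟩ := natVec_injective h'
      exact hne (Prod.ext (Fin.ext e1) (Prod.ext (Fin.ext e2) (Fin.ext e3)))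
    have hfar := le_dist_site_of_ne hA (t 0) (hvec_mem q) (hvec_mem q') hne'
    have hclose : dist (s q) (s q') ≤ 1 / 40 + 1 / 40 := by
      calc dist (s q) (s q') ≤ dist (s q) (x (f q)) + dist (x (f q)) (s q') := dist_triangle _ _ _
        _ ≤ 1 / 40 + 1 / 40 := by
          gcongr
          · rw [dist_comm]; exact hf q
          · rw [hqq]; exact hf q'
    change 189 / 200 ≤ dist (s q) (s q') at hfar
    linarith
  have := Fintype.card_le_of_injective f hinj
  simpa [Fintype.card_prod, Fintype.card_fin, pow_succ, pow_zero, Nat.mul_assoc] using this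

/-- **`N₀(R)` is at least cubic in `R`:** any threshold `N₀` valid at a radius `R ≥ 11/10 + 4K`
satisfies `(K+1)³ ≤ N₀` (test the crux on a ground state with exactly `N₀` particles, which exists by
`LennardJonesGroundStatesExist_holds`).  So `N₀(R) ≥ ((R − 11/10)/4)³`; the honest count of sites in a
matched `R`-ball is `≈ 6.5·R³`. [folklore] -/
theorem coarseGrains_threshold_cubic {R : ℝ} {N₀ : ℕ}
    (h : ∀ N : ℕ, N₀ ≤ N → ∀ x : Fin N → E3, IsGroundState lennardJones x →
      ∃ (c : E3) (t : Fin 2 → E3) (A : E3 →L[ℝ] E3), Adm A ∧ Inner t A ∧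
        Near (Set.range x) c R t A (1 / 40))
    (K : ℕ) (hR : 11 / 10 + 4 * K ≤ R) : (K + 1) ^ 3 ≤ N₀ := by
  obtain ⟨x, hx⟩ := LennardJonesGroundStatesExist_holds N₀
  obtain ⟨c, t, A, hA, -, hN⟩ := h N₀ le_rfl x hx
  exact cube_le_card_of_near hA hN K hR

end Summit.AtomisticToContinuum.Crystallization.Theorems.CoarseGrains.Negative.CubicThreshold

end
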